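import Summits.BirchSwinnertonDyer.BirchSwinnertonDyer.Theorems.PrintCf2RamifiedOffTYZQFormConvolution
import HarnessLib

/-!
# Route `PrintCf2`, crux stmt-BirchSwinnertonDyer-20509 `RamifiedOffTYZOfFacts` — THE EVEN Ω-IDENTITY, ROW (iv) (`x_a x_b`): EXPANSIONS AND CANCELLATIONS
# (cell `bsd-print-cf2`, LEAD of 20509 g14, line `offtyz-v7`, cycle 15; kernel helpers `--supports stmt-BirchSwinnertonDyer-20509`)

Row (iv) of LEAD g13's research statement `EvenOmegaMatrixIdentity` (crux workfile `Cruxes/RamifiedOffTYZOfFacts/Lines/offtyz_v7_EvenOmega.lean`;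
proof `Lines/offtyz_v7_EvenOmegaProof.md` §5, LEAD g14), in the abstract vocabulary of the tree's bipartite forest formula and of the convolution
calculus `…QFormConvolution`: arc weights `a` under the reciprocity law `a s t + a t s = y_s y_t` (on all of `V`), a second vector `z`, a vertex
set `D` with `Σ_D y = 1`; `Y = setExp(q_y)`, `F = setExp(fwt a y z z)`, `W′ = setExp(fwt a y z 0)`, `E = setExp(q_{y+z})`, `f_o = fwt a y z 0`.
For pointing vectors `x, x′` put (the even and odd parts of the `x_a x_b`-rows of the even square form, read through the forest dictionary
of `Lines/offtyz_v7_EvenOmegaProof.md` §1, and the corresponding part of the even Ω-form):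
  `Β_ev(x,x′) = ((p_y p_{x′}((p_x q_z) ⋆ E)) ⋆ W′)(D)`,  `Β_od(x,x′) = ((p_z p_{x′}(q_x ⋆ Y)) ⋆ (f_o ⋆ F))(D)`,  `Tgt(x,x′) = (Σ_D x′)·((p_y q_x) ⋆ F)(D)`.

  **(iv)**  `Β_ev(x,x′) + Β_ev(x′,x) + Β_od(x,x′) + Β_od(x′,x) = Tgt(x,x′) + Tgt(x′,x)`   (proved in the sibling file `…EvenOmegaRowFour`).

THIS FILE (first half of the proof, `Lines/offtyz_v7_EvenOmegaProof.md` §5): §1 support/parity complements to the convolution calculus; §2 the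
Leibniz expansions of both sides (`bev_expand`: twelve terms, `bod_expand`: three, using `E ⋆ W′ = Y ⋆ F`, `Z ⋆ W′ = F`, `p_y Y = Y + δ`, pointed
reciprocity `p_v Y = p_y q_v`, `f_o ⋆ f_o = 0`); §3 the formal cancellations after symmetrisation (`cancel_c1`–`cancel_c4`: `(p_x f_e) ⋆ (p_y q_{x′})`
against the target, `T6 + T11` symmetric, flatness transport `p_x q_z ≡ p_z q_x` on the odd block).  The one non-formal term (pinned pair identity)
and the assembly are in `…EvenOmegaRowFour`.  Pure linear algebra / finite combinatorics over `𝔽₂`; no `sorry`.  BSD is not proved by any of this.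

References: [cite: Chaiken1982, §2]; [cite: Stanley1999EC2, Cor. 5.1.6]; [cite: Smith2016CongruentDensity, §2.2 case 5(b)];
[cite: HeathBrown1994SelmerCongruentII, Appendix (Monsky), typescript p. 41 L20–L36]; crux notes `Lines/offtyz_v7_EvenOmegaProof.md` §5.
-/

namespace Summit.BirchSwinnertonDyer.PrintCf2.QFormForest

open Matrix Finset Literature.LinearAlgebra.Matrix Literature.Combinatorics.Enumerative
open Literature.NumberTheory.EllipticCurves.Smith2016

variable {V : Type*} [Fintype V] [LinearOrder V]

/-! ## §1. Generic complements to the convolution calculus -/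

omit [Fintype V] in
/-- Left-commutativity `f ⋆ (g ⋆ h) = g ⋆ (f ⋆ h)`. [cite: Stanley1999EC2, Cor. 5.1.6] -/
theorem sconv_left_comm (f g h : Finset V → ZMod 2) : sconv f (sconv g h) = sconv g (sconv f h) := by
  rw [← sconv_assoc, sconv_comm f g, sconv_assoc]

omit [Fintype V] in
/-- **Parity of supports adds under convolution**: if `f` is supported on sets with `Σ y = α` and `g` on sets with `Σ y = β`, then `f ⋆ g` is
supported on sets with `Σ y = α + β`. [cite: Stanley1999EC2, Cor. 5.1.6] -/
theorem sconv_support_parity (y : V → ZMod 2) {f g : Finset V → ZMod 2} {α β : ZMod 2}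
    (hf : ∀ X, f X ≠ 0 → ∑ i ∈ X, y i = α) (hg : ∀ X, g X ≠ 0 → ∑ i ∈ X, y i = β) :
    ∀ X, sconv f g X ≠ 0 → ∑ i ∈ X, y i = α + β := by
  intro X hX
  rw [sconv_apply] at hX
  obtain ⟨A, hA, hne⟩ := exists_ne_zero_of_sum_ne_zero hX
  rw [mem_powerset] at hA
  have hfA : f A ≠ 0 := fun h => hne (by rw [h, zero_mul])
  have hgA : g (X \ A) ≠ 0 := fun h => hne (by rw [h, mul_zero])
  rw [← union_sdiff_of_subset hA, sum_union disjoint_sdiff, hf A hfA, hg _ hgA]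

omit [Fintype V] [LinearOrder V] in
/-- A pointed weight `p_y f` is supported on odd sets. [folklore] -/
theorem spoint_support_odd (y : V → ZMod 2) (f : Finset V → ZMod 2) : ∀ X, spoint y f X ≠ 0 → ∑ i ∈ X, y i = 1 := by
  intro X hX
  rw [spoint_apply] at hX
  have h01 : ∀ u : ZMod 2, u ≠ 0 → u = 1 := by decide
  exact h01 _ fun h => hX (by rw [h, zero_mul])

/-- The odd block weight `fwt a y z 0 = p_y q_z` is supported on odd sets. [cite: Chaiken1982, §2] -/
theorem fwt_zero_root_support_odd (a : V → V → ZMod 2) (y z : V → ZMod 2) : ∀ X, fwt a y z 0 X ≠ 0 → ∑ i ∈ X, y i = 1 := by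
  rw [← spoint_qwt_eq_fwt_zero_root]
  exact spoint_support_odd y _

/-- Under the reciprocity law `F = setExp(fwt a y z z)` is supported on even sets. [cite: Chaiken1982, §2] [cite: HornJohnson2013, §0.8.5] -/
theorem setExp_fwt_self_support_even (a : V → V → ZMod 2) (y z : V → ZMod 2) (hrec : ∀ i j : V, i ≠ j → a i j + a j i = y i * y j) :
    ∀ X, setExp (fwt a y z z) X ≠ 0 → ∑ i ∈ X, y i = 0 := by
  intro X hX
  by_contra h
  have h1 : ∑ i ∈ X, y i = 1 := by
    have h01 : ∀ u : ZMod 2, u ≠ 0 → u = 1 := by decide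
    exact h01 _ h
  exact hX (setExp_fwt_self_eq_zero_of_odd a y z hrec h1)

section RowFour

variable (a : V → V → ZMod 2) (y z : V → ZMod 2) (hrec : ∀ i j : V, i ≠ j → a i j + a j i = y i * y j)

/-! ## §2. The Leibniz expansions -/

/-- `p_{x′} E ⋆ W′`: `((p_{x′} setExp(q_{y+z})) ⋆ W′) = (p_{x′}Y) ⋆ F + Y ⋆ (p_{x′} q_z) ⋆ F`. [cite: Stanley1999EC2, Cor. 5.1.6] -/
theorem sconv_spoint_setExp_add_zero_root (x' : V → ZMod 2) :
    sconv (spoint x' (setExp (qwt a (fun i => y i + z i)))) (setExp (fwt a y z 0)) =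
      sconv (spoint x' (setExp (qwt a y))) (setExp (fwt a y z z)) +
        sconv (setExp (qwt a y)) (sconv (spoint x' (qwt a z)) (setExp (fwt a y z z))) := by
  rw [setExp_qwt_add_eq_sconv, spoint_sconv, spoint_setExp x' (qwt a z)]
  simp only [sconv_add_left, sconv_assoc, sconv_setExp_qwt_zero_root]

include hrec in
/-- `p_y E ⋆ W′ = Y ⋆ F + F + Y ⋆ f_o ⋆ F` (`p_y Y = Y + δ`, `p_y Z = f_o ⋆ Z`, `E ⋆ W′ = Y ⋆ F`, `Z ⋆ W′ = F`). [cite: Stanley1999EC2, Cor. 5.1.6] -/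
theorem sconv_spoint_self_setExp_add_zero_root :
    sconv (spoint y (setExp (qwt a (fun i => y i + z i)))) (setExp (fwt a y z 0)) =
      sconv (setExp (qwt a y)) (setExp (fwt a y z z)) + setExp (fwt a y z z) +
        sconv (setExp (qwt a y)) (sconv (fwt a y z 0) (setExp (fwt a y z z))) := by
  rw [setExp_qwt_add_eq_sconv, spoint_sconv, spoint_setExp_qwt_self a y hrec, spoint_setExp_qwt a y z]
  simp only [sconv_add_left, sconv_assoc, sdelta_sconv, sconv_setExp_qwt_zero_root]

include hrec in
/-- `p_y p_{x′} E ⋆ W′`: the six-term expansion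
`(p_{x′}Y)⋆F + Y⋆(p_{x′}q_z)⋆F + (p_{x′}q_z)⋆F + (p_{x′}Y)⋆f_o⋆F + Y⋆(p_{x′}f_o)⋆F + Y⋆(p_{x′}q_z)⋆f_o⋆F` (`f_o = p_y q_z`).
[cite: Stanley1999EC2, Cor. 5.1.6] -/
theorem sconv_spoint_spoint_setExp_add_zero_root (x' : V → ZMod 2) :
    sconv (spoint y (spoint x' (setExp (qwt a (fun i => y i + z i))))) (setExp (fwt a y z 0)) =
      sconv (spoint x' (setExp (qwt a y))) (setExp (fwt a y z z)) +
        sconv (setExp (qwt a y)) (sconv (spoint x' (qwt a z)) (setExp (fwt a y z z))) +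
        sconv (spoint x' (qwt a z)) (setExp (fwt a y z z)) +
        sconv (spoint x' (setExp (qwt a y))) (sconv (fwt a y z 0) (setExp (fwt a y z z))) +
        sconv (setExp (qwt a y)) (sconv (spoint x' (fwt a y z 0)) (setExp (fwt a y z z))) +
        sconv (setExp (qwt a y)) (sconv (spoint x' (qwt a z)) (sconv (fwt a y z 0) (setExp (fwt a y z z)))) := by
  have hpyx : spoint y (spoint x' (setExp (qwt a y))) = spoint x' (setExp (qwt a y)) := by
    rw [spoint_comm, spoint_setExp_qwt_self a y hrec, spoint_add, spoint_sdelta, add_zero]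
  have hpyq : spoint y (spoint x' (qwt a z)) = spoint x' (fwt a y z 0) := by
    rw [spoint_comm, spoint_qwt_eq_fwt_zero_root]
  have hZx : spoint x' (setExp (qwt a z)) = sconv (spoint x' (qwt a z)) (setExp (qwt a z)) := spoint_setExp x' (qwt a z)
  have hZy : spoint y (setExp (qwt a z)) = sconv (fwt a y z 0) (setExp (qwt a z)) := spoint_setExp_qwt a y z
  have hYy : spoint y (setExp (qwt a y)) = setExp (qwt a y) + sdelta := spoint_setExp_qwt_self a y hrec
  simp only [setExp_qwt_add_eq_sconv, spoint_sconv, spoint_add, hZx, hpyx, hZy, hYy, hpyq, sconv_add_left, sconv_add_right, sconv_assoc,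
    sdelta_sconv, sconv_setExp_qwt_zero_root]
  abel

include hrec in
/-- **THE EVEN PART EXPANDED** (twelve terms): `Β_ev(x,x′) = ((p_y p_{x′}((p_x q_z) ⋆ E)) ⋆ W′)` as a sum of convolutions ending in `F`.
[cite: Stanley1999EC2, Cor. 5.1.6] [cite: Chaiken1982, §2] -/
theorem bev_expand (x x' : V → ZMod 2) :
    sconv (spoint y (spoint x' (sconv (spoint x (qwt a z)) (setExp (qwt a (fun i => y i + z i)))))) (setExp (fwt a y z 0)) =
      sconv (spoint y (spoint x' (spoint x (qwt a z)))) (sconv (setExp (qwt a y)) (setExp (fwt a y z z))) +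
      (sconv (spoint x' (spoint x (qwt a z))) (sconv (setExp (qwt a y)) (setExp (fwt a y z z))) +
        sconv (spoint x' (spoint x (qwt a z))) (setExp (fwt a y z z)) +
        sconv (spoint x' (spoint x (qwt a z))) (sconv (setExp (qwt a y)) (sconv (fwt a y z 0) (setExp (fwt a y z z))))) +
      (sconv (spoint y (spoint x (qwt a z))) (sconv (spoint x' (setExp (qwt a y))) (setExp (fwt a y z z))) +
        sconv (spoint y (spoint x (qwt a z))) (sconv (setExp (qwt a y)) (sconv (spoint x' (qwt a z)) (setExp (fwt a y z z))))) +
      (sconv (spoint x (qwt a z)) (sconv (spoint x' (setExp (qwt a y))) (setExp (fwt a y z z))) +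
        sconv (spoint x (qwt a z)) (sconv (setExp (qwt a y)) (sconv (spoint x' (qwt a z)) (setExp (fwt a y z z)))) +
        sconv (spoint x (qwt a z)) (sconv (spoint x' (qwt a z)) (setExp (fwt a y z z))) +
        sconv (spoint x (qwt a z)) (sconv (spoint x' (setExp (qwt a y))) (sconv (fwt a y z 0) (setExp (fwt a y z z)))) +
        sconv (spoint x (qwt a z)) (sconv (setExp (qwt a y)) (sconv (spoint x' (fwt a y z 0)) (setExp (fwt a y z z)))) +
        sconv (spoint x (qwt a z)) (sconv (setExp (qwt a y)) (sconv (spoint x' (qwt a z)) (sconv (fwt a y z 0) (setExp (fwt a y z z)))))) := by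
  have h1 := sconv_setExp_qwt_add_zero_root a y z
  have h2 := sconv_spoint_self_setExp_add_zero_root a y z hrec
  have h3 := sconv_spoint_setExp_add_zero_root a y z x'
  have h4 := sconv_spoint_spoint_setExp_add_zero_root a y z hrec x'
  rw [spoint_sconv, spoint_add, spoint_sconv, spoint_sconv]
  simp only [sconv_add_left, sconv_assoc, h1, h2, h3, h4, sconv_add_right]
  abel

include hrec in
/-- **THE ODD PART EXPANDED** (three terms; the fourth, `(p_{x′}q_x) ⋆ f_o ⋆ f_o ⋆ F`, dies by pair cancellation):
`Β_od(x,x′) = ((p_z p_{x′} q_x) ⋆ Y + (p_z q_x) ⋆ (p_y q_{x′}) + q_x ⋆ (p_{x′} f_o)) ⋆ (f_o ⋆ F)` (pointed reciprocity `p_{x′} Y = p_y q_{x′}`, `p_z Y = f_o`).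
[cite: Stanley1999EC2, Cor. 5.1.6] [cite: Smith2016CongruentDensity, §2.2 case 5(b)] -/
theorem bod_expand (x x' : V → ZMod 2) :
    sconv (spoint z (spoint x' (sconv (qwt a x) (setExp (qwt a y))))) (sconv (fwt a y z 0) (setExp (fwt a y z z))) =
      sconv (sconv (spoint z (spoint x' (qwt a x))) (setExp (qwt a y)) + sconv (spoint z (qwt a x)) (spoint y (qwt a x')) +
        sconv (qwt a x) (spoint x' (fwt a y z 0))) (sconv (fwt a y z 0) (setExp (fwt a y z z))) := by
  have hzx : spoint z (spoint x' (setExp (qwt a y))) = spoint x' (fwt a y z 0) := by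
    rw [spoint_comm, spoint_setExp_qwt_eq_fwt_zero_root a y z hrec]
  rw [spoint_sconv, spoint_add, spoint_sconv, spoint_sconv, spoint_setExp_qwt_eq_fwt_zero_root a y z hrec, hzx,
    spoint_setExp_qwt_eq a y hrec x']
  -- the term `(p_{x′} q_x) ⋆ f_o ⋆ f_o ⋆ F` vanishes
  have h0 : sconv (sconv (spoint x' (qwt a x)) (fwt a y z 0)) (sconv (fwt a y z 0) (setExp (fwt a y z z))) = 0 := by
    have hfo : fwt a y z 0 ∅ = 0 := by rw [fwt_zero_root_apply, sum_empty, zero_mul]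
    rw [sconv_assoc, ← sconv_assoc (fwt a y z 0), sconv_self_eq_zero hfo, zero_sconv, sconv_zero]
  simp only [sconv_add_left, h0, add_zero]
  abel

/-! ## §3. The cancellations -/

/-- `f_o + q_z = f_e` (`(Σy)q_z + q_z = (1+Σy)q_z`). [cite: Chaiken1982, §2] -/
theorem fwt_zero_root_add_qwt : fwt a y z 0 + qwt a z = fwt a y z z := by
  funext B
  rw [Pi.add_apply, fwt_zero_root_apply, fwt]

omit [Fintype V] in
/-- Three-fold symmetry `A ⋆ (G ⋆ (B ⋆ H)) = B ⋆ (G ⋆ (A ⋆ H))`. [cite: Stanley1999EC2, Cor. 5.1.6] -/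
theorem sconv_swap_outer (A B G H : Finset V → ZMod 2) : sconv A (sconv G (sconv B H)) = sconv B (sconv G (sconv A H)) := by
  rw [sconv_left_comm A G, sconv_left_comm A B, ← sconv_left_comm G B]

/-- **(c1) `T5 + T7` is the swapped target term `U8`**: `(p_y p_x q_z) ⋆ (p_{x′}Y) ⋆ F + (p_x q_z) ⋆ (p_{x′}Y) ⋆ F = (p_y q_{x′}) ⋆ (p_x f_e) ⋆ F`
(`p_y p_x q_z = p_x f_o`, `f_o + q_z = f_e`, pointed reciprocity `p_{x′} Y = p_y q_{x′}`). [cite: Smith2016CongruentDensity, §2.2 case 5(b)] -/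
theorem cancel_c1 (x x' : V → ZMod 2) :
    sconv (spoint y (spoint x (qwt a z))) (sconv (spoint y (qwt a x')) (setExp (fwt a y z z))) +
        sconv (spoint x (qwt a z)) (sconv (spoint y (qwt a x')) (setExp (fwt a y z z))) =
      sconv (spoint y (qwt a x')) (sconv (spoint x (fwt a y z z)) (setExp (fwt a y z z))) := by
  rw [spoint_comm, spoint_qwt_eq_fwt_zero_root, ← sconv_add_left, ← spoint_add, fwt_zero_root_add_qwt, sconv_left_comm]

include hrec in
/-- **(c2) the first target term is symmetric**: `p_{x′} p_y q_x = p_x p_y q_{x′}` (pointed flatness). [cite: Smith2016CongruentDensity, §2.2] -/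
theorem cancel_c2 (x x' : V → ZMod 2) :
    sconv (spoint x' (spoint y (qwt a x))) (setExp (fwt a y z z)) = sconv (spoint x (spoint y (qwt a x'))) (setExp (fwt a y z z)) := by
  rw [spoint_spoint_qwt_comm a y hrec x' x]

/-- **(c3) `T6 + T11` is symmetric in `x ↔ x′`**: with `q_z = f_e + f_o` both orders give `(p_x f_o)⋆Y⋆(p_{x′}f_e)⋆F + (p_x f_e)⋆Y⋆(p_{x′}f_o)⋆F`.
[cite: Stanley1999EC2, Cor. 5.1.6] -/
theorem cancel_c3 (x x' : V → ZMod 2) (D : Finset V) :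
    (sconv (spoint y (spoint x (qwt a z))) (sconv (setExp (qwt a y)) (sconv (spoint x' (qwt a z)) (setExp (fwt a y z z)))) +
        sconv (spoint x (qwt a z)) (sconv (setExp (qwt a y)) (sconv (spoint x' (fwt a y z 0)) (setExp (fwt a y z z))))) D =
      (sconv (spoint y (spoint x' (qwt a z))) (sconv (setExp (qwt a y)) (sconv (spoint x (qwt a z)) (setExp (fwt a y z z)))) +
        sconv (spoint x' (qwt a z)) (sconv (setExp (qwt a y)) (sconv (spoint x (fwt a y z 0)) (setExp (fwt a y z z))))) D := by
  have hq : ∀ v : V → ZMod 2, spoint v (qwt a z) = spoint v (fwt a y z 0) + spoint v (fwt a y z z) := by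
    intro v; rw [← spoint_add]; congr 1; rw [← fwt_zero_root_add_qwt a y z, ← add_assoc, add_self_weight, zero_add]
  have hL : ∀ u v : V → ZMod 2,
      (sconv (spoint y (spoint u (qwt a z))) (sconv (setExp (qwt a y)) (sconv (spoint v (qwt a z)) (setExp (fwt a y z z)))) +
        sconv (spoint u (qwt a z)) (sconv (setExp (qwt a y)) (sconv (spoint v (fwt a y z 0)) (setExp (fwt a y z z))))) D =
      sconv (spoint u (fwt a y z 0)) (sconv (setExp (qwt a y)) (sconv (spoint v (fwt a y z z)) (setExp (fwt a y z z)))) D +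
        sconv (spoint u (fwt a y z z)) (sconv (setExp (qwt a y)) (sconv (spoint v (fwt a y z 0)) (setExp (fwt a y z z)))) D := by
    intro u v
    rw [spoint_comm, spoint_qwt_eq_fwt_zero_root, hq v, hq u]
    simp only [sconv_add_left, sconv_add_right, Pi.add_apply]
    grind
  rw [hL x x', hL x' x, sconv_swap_outer (spoint x (fwt a y z 0)), sconv_swap_outer (spoint x (fwt a y z z)), add_comm]

include hrec in
/-- **(c4) flatness transport `T10 = U4`**: at `D` with `Σ_D y = 1`,
`((p_x q_z) ⋆ (p_y q_{x′}) ⋆ f_o ⋆ F)(D) = ((p_z q_x) ⋆ (p_y q_{x′}) ⋆ f_o ⋆ F)(D)` — the co-factor `(p_y q_{x′}) ⋆ f_o ⋆ F` lives on even sets, so the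
first block is odd and `(Σx)q_z = (Σz)q_x` there (flatness). [cite: Smith2016CongruentDensity, §2.2 (chunk p0008 L42–L50)] -/
theorem cancel_c4 {D : Finset V} (hyD : ∑ i ∈ D, y i = 1) (x x' : V → ZMod 2) :
    sconv (spoint x (qwt a z)) (sconv (spoint y (qwt a x')) (sconv (fwt a y z 0) (setExp (fwt a y z z)))) D =
      sconv (sconv (spoint z (qwt a x)) (spoint y (qwt a x'))) (sconv (fwt a y z 0) (setExp (fwt a y z z))) D := by
  rw [sconv_assoc]
  refine sconv_congr_left fun A hA hG => ?_
  -- the co-factor is supported on even sets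
  have hpar := sconv_support_parity y (spoint_support_odd y (qwt a x'))
    (sconv_support_parity y (fwt_zero_root_support_odd a y z) (setExp_fwt_self_support_even a y z hrec)) _ hG
  have hsplit : ∑ i ∈ D, y i = ∑ i ∈ A, y i + ∑ i ∈ D \ A, y i := by
    rw [← sum_union disjoint_sdiff, union_sdiff_of_subset hA]
  rw [hyD, hpar] at hsplit
  have hA1 : ∑ i ∈ A, y i = 1 := by
    have e : ∀ u : ZMod 2, 1 = u + (1 + (1 + 0)) → u = 1 := by decide
    exact e _ hsplit
  exact spoint_qwt_symm_of_odd a y hrec x z hA1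

end RowFour

end Summit.BirchSwinnertonDyer.PrintCf2.QFormForest
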